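import Summits.ValiantsHypothesis.ValiantsHypothesis.Theorems.BarrierLeverDefinableEquationsBoolSumFourier

/-!
# Cruxes `BarrierLever.DefinableEquations` (8745) / `SingleSizeEquations` (8749) — LEADING FORMS:
# unitriangular substitutions keep the top weighted-homogeneous component

Generic lemmas (any variable type, coefficients in `ℂ`) for the "U-half" of the normal-form
programme (design memo `HWV-NORMAL-FORM-PLAN.md`, evidence #9 on stmt-ValiantsHypothesis-8749).
Fix a weight `W : σ → ℕ`.  A substitution `Φ` is UNITRIANGULAR for `W` if `Φ(x_v) = x_v + R_v` with
every monomial of `R_v` of weight `< W v`.  THEOREM (`weightedHomogeneousComponent_aeval_unitri`):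
for such `Φ` and any `P` all of whose monomials have weight `≤ d`,

  `(P ∘ Φ)_d = P_d`   (weight-`d` components),

because `P ∘ Φ - P` only has monomials of weight strictly below the weight of some monomial of
`P` (`lower_aeval_unitri_sub`).  Applied in `…UnipotentInvariants.lean` to the group law of the
unitriangular group in matrix-entry coordinates (`s_kj ↦ s_kj + t_kj + Σ_{k<i<j} s_ki t_ij`, root
height `W(k,j) = j - k`), it shows that the top root-height component of `s ↦ E(T_s c)` is
`U`-invariant.  Also: the top component of a nonzero polynomial is nonzero
(`weightedHomogeneousComponent_top_ne_zero`), a nonzero polynomial in two blocks of variables has a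
nonzero specialisation of the first block (`exists_aeval_const_ne_zero`), and coefficient
extraction from a Laurent-free identity in one parameter (`eq_zero_of_sum_pow_mul_eq_zero`).

Elementary commutative algebra; no definitions, no named facts.  References: [Burgisser2000] §2.1
(frame); [LandsbergGCT2017] §8 (highest weight vectors).
-/

-- layout Summits/ValiantsHypothesis/ValiantsHypothesis forces the duplicated namespace component
set_option linter.dupNamespace false

noncomputable section

open MvPolynomial

namespace Summit.ValiantsHypothesis.ValiantsHypothesis.Theorems.BarrierLever.IsobaricEquations

variable {σ : Type*} (W : σ → ℕ)

/-! ## §1 Monomials below a weight -/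

/-- `Q * A` has all monomials of weight `< w₁ + w₂` if `Q` has all monomials of weight `< w₁` and
`A` all monomials of weight `≤ w₂`. [folklore] -/
theorem lower_mul_le {Q A : MvPolynomial σ ℂ} {w₁ w₂ : ℕ}
    (hQ : ∀ γ ∈ Q.support, Finsupp.weight W γ < w₁) (hA : ∀ γ ∈ A.support, Finsupp.weight W γ ≤ w₂) :
    ∀ γ ∈ (Q * A).support, Finsupp.weight W γ < w₁ + w₂ := by
  classical
  intro γ hγ
  obtain ⟨a, ha, b, hb, rfl⟩ := Finset.mem_add.mp (support_mul Q A hγ)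
  rw [map_add]
  exact add_lt_add_of_lt_of_le (hQ a ha) (hA b hb)

/-- Symmetric form of `lower_mul_le`. [folklore] -/
theorem le_mul_lower {A Q : MvPolynomial σ ℂ} {w₁ w₂ : ℕ}
    (hA : ∀ γ ∈ A.support, Finsupp.weight W γ ≤ w₁) (hQ : ∀ γ ∈ Q.support, Finsupp.weight W γ < w₂) :
    ∀ γ ∈ (A * Q).support, Finsupp.weight W γ < w₁ + w₂ := by
  rw [mul_comm, add_comm]; exact lower_mul_le W hQ hA

/-- Sums stay below a weight. [folklore] -/
theorem lower_add {Q₁ Q₂ : MvPolynomial σ ℂ} {w : ℕ}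
    (h₁ : ∀ γ ∈ Q₁.support, Finsupp.weight W γ < w) (h₂ : ∀ γ ∈ Q₂.support, Finsupp.weight W γ < w) :
    ∀ γ ∈ (Q₁ + Q₂).support, Finsupp.weight W γ < w := by
  classical
  intro γ hγ
  rcases Finset.mem_union.mp (support_add hγ) with h | h
  · exact h₁ γ h
  · exact h₂ γ h

/-- A polynomial with monomials of weight `< w`, plus one of weight `= w`... : if `Φ v = x_v + R_v`
with `R_v` below `W v`, then all monomials of `Φ v` have weight `≤ W v`. [folklore] -/
theorem le_of_X_add_lower {v : σ} {Rv : MvPolynomial σ ℂ}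
    (hR : ∀ γ ∈ Rv.support, Finsupp.weight W γ < W v) :
    ∀ γ ∈ (X v + Rv).support, Finsupp.weight W γ ≤ W v := by
  classical
  intro γ hγ
  rcases Finset.mem_union.mp (support_add hγ) with h | h
  · rw [support_X, Finset.mem_singleton] at h
    rw [h, Finsupp.weight_single, smul_eq_mul, one_mul]
  · exact (hR γ h).le

/-! ## §2 Unitriangular substitutions -/

section unitri

variable {Φ : σ → MvPolynomial σ ℂ}
  (hΦ : ∀ v, ∀ γ ∈ (Φ v - X v).support, Finsupp.weight W γ < W v)
include hΦ

/-- Powers of one variable: `Φ(x_v)^b - x_v^b` lies below weight `b · W v`. [folklore] -/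
theorem lower_aeval_unitri_X_pow (v : σ) :
    ∀ b : ℕ, ∀ γ ∈ (aeval Φ (X v ^ b : MvPolynomial σ ℂ) - (X v ^ b : MvPolynomial σ ℂ)).support,
      Finsupp.weight W γ < b * W v
  | 0 => by simp
  | b + 1 => by
    have hsplit : aeval Φ (X v ^ (b + 1) : MvPolynomial σ ℂ) - (X v ^ (b + 1) : MvPolynomial σ ℂ) =
        (aeval Φ (X v ^ b : MvPolynomial σ ℂ) - (X v ^ b : MvPolynomial σ ℂ)) * Φ v +
          (X v ^ b : MvPolynomial σ ℂ) * (Φ v - X v) := by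
      rw [pow_succ, map_mul, aeval_X]; ring
    rw [hsplit, Nat.succ_mul]
    refine lower_add W (lower_mul_le W (lower_aeval_unitri_X_pow v b) ?_) (le_mul_lower W ?_ (hΦ v))
    · have h := le_of_X_add_lower W (hΦ v)
      rwa [add_sub_cancel] at h
    · intro γ hγ
      classical
      rw [support_X_pow, Finset.mem_singleton] at hγ
      rw [hγ, Finsupp.weight_single, smul_eq_mul]

/-- Monomials: `Φ(x^α) - x^α` lies below the weight of `α`. [folklore] -/
theorem lower_aeval_unitri_monomial (α : σ →₀ ℕ) :
    ∀ γ ∈ (aeval Φ (monomial α (1 : ℂ)) - monomial α 1).support,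
      Finsupp.weight W γ < Finsupp.weight W α := by
  classical
  induction α using Finsupp.induction with
  | zero => simp
  | single_add v b α' hv hb ih =>
    have hsplit : aeval Φ (monomial (Finsupp.single v b + α') (1 : ℂ)) -
        monomial (Finsupp.single v b + α') (1 : ℂ) =
        (aeval Φ (X v ^ b : MvPolynomial σ ℂ) - (X v ^ b : MvPolynomial σ ℂ)) *
            aeval Φ (monomial α' (1 : ℂ)) +
          (X v ^ b : MvPolynomial σ ℂ) * (aeval Φ (monomial α' (1 : ℂ)) - monomial α' (1 : ℂ)) := by
      rw [monomial_single_add, map_mul]; ring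
    rw [hsplit, map_add, Finsupp.weight_single, smul_eq_mul]
    refine lower_add W (lower_mul_le W (lower_aeval_unitri_X_pow W hΦ v b) ?_) (le_mul_lower W ?_ ih)
    · -- monomials of `Φ(x^{α'})` have weight `≤ weight α'`
      intro γ hγ
      by_cases hγ' : γ ∈ (aeval Φ (monomial α' (1 : ℂ)) - monomial α' 1).support
      · exact (ih γ hγ').le
      · -- then `γ = α'`
        have hco : coeff γ (aeval Φ (monomial α' (1 : ℂ)) - monomial α' 1) = 0 :=
          notMem_support_iff.mp hγ'
        rw [coeff_sub, sub_eq_zero] at hco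
        have hne : coeff γ (monomial α' (1 : ℂ)) ≠ 0 := by rw [← hco]; exact mem_support_iff.mp hγ
        rw [coeff_monomial] at hne
        by_cases h : α' = γ
        · rw [h]
        · rw [if_neg h] at hne; exact absurd rfl hne
    · intro γ hγ
      rw [support_X_pow, Finset.mem_singleton] at hγ
      rw [hγ, Finsupp.weight_single, smul_eq_mul]

/-- **`P ∘ Φ - P` lies strictly below `P`**: every monomial of `aeval Φ P - P` has weight less than
the weight of some monomial of `P`. [folklore] -/
theorem lower_aeval_unitri_sub (P : MvPolynomial σ ℂ) :
    ∀ γ ∈ (aeval Φ P - P).support, ∃ α ∈ P.support, Finsupp.weight W γ < Finsupp.weight W α := by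
  classical
  intro γ hγ
  have hsum : aeval Φ P - P =
      ∑ α ∈ P.support, C (coeff α P) * (aeval Φ (monomial α (1 : ℂ)) - monomial α (1 : ℂ)) := by
    have h1 : ∀ α : σ →₀ ℕ, C (coeff α P) * (aeval Φ (monomial α (1 : ℂ)) - monomial α (1 : ℂ)) =
        aeval Φ (monomial α (coeff α P)) - monomial α (coeff α P) := fun α => by
      rw [mul_sub, C_mul_monomial, mul_one, show C (coeff α P) * aeval Φ (monomial α (1 : ℂ)) =
        aeval Φ (C (coeff α P) * monomial α 1) by rw [map_mul, algHom_C, algebraMap_eq], C_mul_monomial,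
        mul_one]
    simp_rw [h1]
    rw [Finset.sum_sub_distrib, ← map_sum, ← P.as_sum]
  rw [hsum] at hγ
  obtain ⟨α, hα, hγα⟩ := Finset.mem_biUnion.mp (support_sum hγ)
  refine ⟨α, hα, lower_aeval_unitri_monomial W hΦ α γ ?_⟩
  rw [C_mul'] at hγα
  exact support_smul hγα

/-- **Unitriangular substitutions keep the top weighted-homogeneous component**: if every monomial
of `P` has weight `≤ d`, then `(P ∘ Φ)_d = P_d`. [folklore] -/
theorem weightedHomogeneousComponent_aeval_unitri (P : MvPolynomial σ ℂ) (d : ℕ)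
    (hd : ∀ α ∈ P.support, Finsupp.weight W α ≤ d) :
    weightedHomogeneousComponent W d (aeval Φ P) = weightedHomogeneousComponent W d P := by
  classical
  have hsplit : aeval Φ P = P + (aeval Φ P - P) := by ring
  rw [hsplit, map_add, add_eq_left]
  refine weightedHomogeneousComponent_eq_zero' d _ fun γ hγ => ?_
  obtain ⟨α, hα, hlt⟩ := lower_aeval_unitri_sub W hΦ P γ hγ
  exact (lt_of_lt_of_le hlt (hd α hα)).ne

end unitri

/-! ## §3 Top components, specialisations, coefficient extraction -/

/-- The weighted total degree bounds the weight of every monomial (restated). [folklore] -/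
theorem weight_le_weightedTotalDegree {P : MvPolynomial σ ℂ} {α : σ →₀ ℕ} (hα : α ∈ P.support) :
    Finsupp.weight W α ≤ weightedTotalDegree W P :=
  le_weightedTotalDegree W hα

/-- **The top component of a nonzero polynomial is nonzero.** [folklore] -/
theorem weightedHomogeneousComponent_top_ne_zero {P : MvPolynomial σ ℂ} (hP : P ≠ 0) :
    weightedHomogeneousComponent W (weightedTotalDegree W P) P ≠ 0 := by
  classical
  have hne : P.support.Nonempty := Finset.nonempty_iff_ne_empty.2 (support_eq_empty.not.2 hP)
  obtain ⟨α, hα, hsup⟩ := Finset.exists_mem_eq_sup P.support hne (fun α => Finsupp.weight W α)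
  have hdeg : weightedTotalDegree W P = Finsupp.weight W α := by
    rw [weightedTotalDegree]; exact hsup
  intro h
  have hco := congrArg (coeff α) h
  rw [coeff_weightedHomogeneousComponent, if_pos hdeg.symm, coeff_zero] at hco
  exact (mem_support_iff.mp hα) hco

/-- **A nonzero polynomial in two blocks of variables has a nonzero specialisation of the first
block** (over an infinite field). [folklore] -/
theorem exists_aeval_const_ne_zero {S ι : Type*} {P : MvPolynomial (S ⊕ ι) ℂ} (hP : P ≠ 0) :
    ∃ s₀ : S → ℂ, aeval (Sum.elim (fun p => C (s₀ p)) X : S ⊕ ι → MvPolynomial ι ℂ) P ≠ 0 := by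
  by_contra hall
  push Not at hall
  apply hP
  refine MvPolynomial.funext fun x => ?_
  rw [map_zero]
  have h := hall (x ∘ Sum.inl)
  have hpt : (fun v => eval (x ∘ Sum.inr) ((Sum.elim (fun p => C ((x ∘ Sum.inl) p)) X :
      S ⊕ ι → MvPolynomial ι ℂ) v)) = x := by
    funext v
    rcases v with p | m
    · simp
    · simp
  have hev : eval (x ∘ Sum.inr) (aeval (Sum.elim (fun p => C ((x ∘ Sum.inl) p)) X :
      S ⊕ ι → MvPolynomial ι ℂ) P) = eval x P := by
    rw [BoolSumComponents.eval_aeval_eq, hpt]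
  rw [← hev, h, map_zero]

/-- **Coefficient extraction in one parameter**: if `Σ_{J ≤ D} τ^J a_J = 0` for every `τ ≠ 0`,
then all `a_J = 0`. [folklore] -/
theorem eq_zero_of_sum_pow_mul_eq_zero (a : ℕ → ℂ) (D : ℕ)
    (h : ∀ τ : ℂ, τ ≠ 0 → ∑ J ∈ Finset.range (D + 1), τ ^ J * a J = 0) :
    ∀ J ∈ Finset.range (D + 1), a J = 0 := by
  set P : Polynomial ℂ := ∑ J ∈ Finset.range (D + 1), Polynomial.C (a J) * Polynomial.X ^ J with hP
  have hroots : Set.Infinite {x : ℂ | P.IsRoot x} := by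
    refine Set.Infinite.mono (s := {x : ℂ | x ≠ 0}) (fun τ hτ => ?_) ?_
    · simp only [Set.mem_setOf_eq, Polynomial.IsRoot.def, hP, Polynomial.eval_finsetSum,
        Polynomial.eval_mul, Polynomial.eval_C, Polynomial.eval_pow, Polynomial.eval_X]
      rw [← h τ hτ]
      exact Finset.sum_congr rfl fun J _ => mul_comm _ _
    · exact (Set.finite_singleton (0 : ℂ)).infinite_compl |>.mono fun x hx => hx
  have hP0 : P = 0 := Polynomial.eq_zero_of_infinite_isRoot P hroots
  intro J hJ
  have hco := congrArg (fun Q => Polynomial.coeff Q J) hP0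
  simp only [hP, Polynomial.finsetSum_coeff, Polynomial.coeff_C_mul_X_pow, Polynomial.coeff_zero] at hco
  rw [Finset.sum_eq_single J, if_pos rfl] at hco
  · exact hco
  · intro J' _ hJ'; rw [if_neg (Ne.symm hJ')]
  · intro hJn; exact absurd hJ hJn

end Summit.ValiantsHypothesis.ValiantsHypothesis.Theorems.BarrierLever.IsobaricEquations

end
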